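import Summits.NavierStokesRegularity.NavierStokesRegularity.Theses.AxisymmetricExtremality
import Summits.NavierStokesRegularity.NavierStokesRegularity.Theorems.AxisymmetricExtremalityAxisymmetricKatoGlobalNoSwirlStratum
import Literature.Analysis.FluidPDE.AxisymmetricReflection
import HarnessLib

/-!
# Strategist s17-g3 (independent census, family `s`) — typed companion to
# `STRATEGY-CENSUS-s17-g3.md` for crux `AxisymmetricExtremality.AxisymmetricKatoGlobal`
# (stmt-NavierStokesRegularity-15453)

Everything here is PURE LOGIC over the route file; no NS regularity statement is proved.
It certifies the "weaker intermediate from the summit" part of the census: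

* `NoAxisymMinimalBlowupDatum` (W0) — the threshold instance of the crux that `closes` actually
  consumes; `w0_of_crux : AxisymmetricKatoGlobal → W0`, `closes_of_w0 : MinimalDatumPFold →
  PFoldToAxisymmetric → W0 → NavierStokesRegularity`.
* `NoPFoldMinimalEventually` (W3) — "for large p there is no p-fold minimal blow-up datum";
  `closes_of_w3 : MinimalDatumPFold → W3 → NavierStokesRegularity` (does NOT use
  PFoldToAxisymmetric); `w0_of_w3`, `w3_of_w0` (the latter through the PROVED PFoldToAxisymmetric):
  W3 ⟺ W0 over the tree.
* `AxisymKatoGlobalFiniteEnergy` (D3's open piece, the crux restricted to `L² ∩ L³` data) with the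
  trivial direction `finiteEnergy_of_crux`.
* `AxisymThresholdBelowGlobal` (D5's provable half is existence of an axisymmetric critical
  element; the rigidity half below is the crux reworded — recorded, not claimed new).
* `noO2MinimalBlowupDatum` — **W0 restricted to the O(2)-stratum (axisymmetric AND equivariant
  under the meridian reflection σ) is a THEOREM of the tree** (kernel-unconditional: the landed
  no-swirl stratum `…NoSwirlStratum.axisymmetricKatoGlobal_noSwirl_stratum` + the folklore lemma
  `IsAxisymmetric.hasNoSwirl_of_reflY_eq`: O(2)-equivariance kills the swirl). The distance from
  the proved rung to W0 is exactly one reflection = the swirl; see the census, §Transfer T3 and the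
  route-level note (`closes_via_dihedral`: with dihedral D_n in place of cyclic C_p symmetry the
  route's deciding theorem needs NO axisymmetric-with-swirl input at all — all open content moves
  into the Smith-type crux; recorded for the tenure planner, not a crux output).
-/

set_option linter.dupNamespace false

namespace Summit.NavierStokesRegularity.NavierStokesRegularity.Cruxes.AxisymmetricKatoGlobal.StrategistS17g3

open Summit.NavierStokesRegularity.NavierStokesRegularity.Theses.AxisymmetricExtremality
open MeasureTheory

/-- Axisymmetry about the `x₂`-axis, written out exactly as in the route file
(`Literature.Analysis.FluidPDE.IsAxisymmetric u₀` unfolded). -/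
def AxisymUnfolded (u₀ : EuclideanSpace ℝ (Fin 3) → EuclideanSpace ℝ (Fin 3)) : Prop :=
  ∀ (θ : ℝ) (x : EuclideanSpace ℝ (Fin 3)),
    u₀ (WithLp.toLp 2 ![Real.cos θ * x 0 - Real.sin θ * x 1, Real.sin θ * x 0 + Real.cos θ * x 1, x 2]) =
      WithLp.toLp 2 ![Real.cos θ * u₀ x 0 - Real.sin θ * u₀ x 1, Real.sin θ * u₀ x 0 + Real.cos θ * u₀ x 1, u₀ x 2]

/-- `p`-fold symmetry about the `x₂`-axis, written out exactly as in `MinimalDatumPFold`. -/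
def PFoldUnfolded (p : ℕ) (u₀ : EuclideanSpace ℝ (Fin 3) → EuclideanSpace ℝ (Fin 3)) : Prop :=
  ∀ x : EuclideanSpace ℝ (Fin 3),
    u₀ (WithLp.toLp 2 ![Real.cos (2 * Real.pi / p) * x 0 - Real.sin (2 * Real.pi / p) * x 1,
        Real.sin (2 * Real.pi / p) * x 0 + Real.cos (2 * Real.pi / p) * x 1, x 2]) =
      WithLp.toLp 2 ![Real.cos (2 * Real.pi / p) * u₀ x 0 - Real.sin (2 * Real.pi / p) * u₀ x 1,
        Real.sin (2 * Real.pi / p) * u₀ x 0 + Real.cos (2 * Real.pi / p) * u₀ x 1, u₀ x 2]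

/-! ## W0 — the threshold instance of the crux -/

/-- **W0.** For every `ν > 0` there is no axisymmetric Rusin–Šverák minimal blow-up datum. This is
exactly what `closes` consumes of `AxisymmetricKatoGlobal`. -/
def NoAxisymMinimalBlowupDatum : Prop :=
  ∀ ν : ℝ, 0 < ν →
    ¬ ∃ (u₀ : EuclideanSpace ℝ (Fin 3) → EuclideanSpace ℝ (Fin 3))
        (g : Literature.Analysis.FunctionSpaces.HomSobolev (EuclideanSpace ℝ (Fin 3))
          (EuclideanSpace ℂ (Fin 3)) (1 / 2 : ℝ)),
      Literature.Analysis.FluidPDE.IsMinimalBlowupDatum ν u₀ g ∧ AxisymUnfolded u₀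

/-- The crux implies its threshold instance (drop the norm clause of minimality). -/
theorem w0_of_crux (h : AxisymmetricKatoGlobal) : NoAxisymMinimalBlowupDatum := by
  rintro ν hν ⟨u₀, g, ⟨hL3, hrep, hdiv, -, hnot⟩, hax⟩
  exact hnot (h ν hν u₀ g hL3 hrep hdiv hax)

/-- `closes` with the crux replaced by W0 — the same three lines of logic. -/
theorem closes_of_w0 (h₂ : MinimalDatumPFold) (h₄ : PFoldToAxisymmetric)
    (h₀ : NoAxisymMinimalBlowupDatum) : NavierStokesRegularity := by
  show Literature.NS.NavierStokesExistenceSmoothR3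
  intro ν hν u₀ hsm hdiv hdec
  by_contra hno
  exact h₀ ν hν (h₄ ν hν (h₂ ν hν ⟨u₀, hsm, hdiv, hdec, hno⟩))

/-! ## W3 — no `p`-fold minimal data for large `p` -/

/-- **W3.** For every `ν > 0` there is `N` such that no `p ≥ max(N,2)`-fold symmetric minimal
blow-up datum exists. -/
def NoPFoldMinimalEventually : Prop :=
  ∀ ν : ℝ, 0 < ν → ∃ N : ℕ, ∀ p : ℕ, N ≤ p → 2 ≤ p →
    ¬ ∃ (u₀ : EuclideanSpace ℝ (Fin 3) → EuclideanSpace ℝ (Fin 3))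
        (g : Literature.Analysis.FunctionSpaces.HomSobolev (EuclideanSpace ℝ (Fin 3))
          (EuclideanSpace ℂ (Fin 3)) (1 / 2 : ℝ)),
      Literature.Analysis.FluidPDE.IsMinimalBlowupDatum ν u₀ g ∧ PFoldUnfolded p u₀

/-- `closes` from `MinimalDatumPFold` and W3 alone — `PFoldToAxisymmetric` is not needed. -/
theorem closes_of_w3 (h₂ : MinimalDatumPFold) (h₃ : NoPFoldMinimalEventually) :
    NavierStokesRegularity := by
  show Literature.NS.NavierStokesExistenceSmoothR3
  intro ν hν u₀ hsm hdiv hdec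
  by_contra hno
  obtain ⟨N, hN⟩ := h₃ ν hν
  obtain ⟨p, hNp, h2p, u₁, g, hmin, hsym⟩ := h₂ ν hν ⟨u₀, hsm, hdiv, hdec, hno⟩ N
  exact hN p hNp h2p ⟨u₁, g, hmin, hsym⟩

/-- W3 ⇒ W0: an axisymmetric datum is `p`-fold symmetric for every `p`. -/
theorem w0_of_w3 (h : NoPFoldMinimalEventually) : NoAxisymMinimalBlowupDatum := by
  rintro ν hν ⟨u₀, g, hmin, hax⟩
  obtain ⟨N, hN⟩ := h ν hν
  exact hN (max N 2) (le_max_left _ _) (le_max_right _ _) ⟨u₀, g, hmin, fun x => hax _ x⟩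

/-- W0 ⇒ W3 through `PFoldToAxisymmetric` (PROVED in the tree:
`Theorems.axisymmetricExtremality_pFoldToAxisymmetric_proof`, taken here as a hypothesis to keep the
import cone at the route file). Hence W3 ⟺ W0 over the tree. -/
theorem w3_of_w0 (h₄ : PFoldToAxisymmetric) (h₀ : NoAxisymMinimalBlowupDatum) :
    NoPFoldMinimalEventually := by
  intro ν hν
  by_contra hne
  push Not at hne
  exact h₀ ν hν (h₄ ν hν fun N => hne N)

/-! ## D3 — finite-energy reduction: the open piece -/

/-- **D3, open piece.** The crux restricted to finite-energy critical data (`u₀ ∈ L² ∩ L³`,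
axisymmetric, weakly divergence-free, represented in `Ḣ^{1/2}`). Formally weaker than the crux
(`finiteEnergy_of_crux`); informally it is still axisymmetric-with-swirl regularity for Leray–Hopf
solutions with `H^{1/2}` data (ns.S25) — the census explains why the Calderón splitting that would
give the converse needs exactly this. -/
def AxisymKatoGlobalFiniteEnergy : Prop :=
  ∀ ν : ℝ, 0 < ν → ∀ (u₀ : EuclideanSpace ℝ (Fin 3) → EuclideanSpace ℝ (Fin 3))
    (g : Literature.Analysis.FunctionSpaces.HomSobolev (EuclideanSpace ℝ (Fin 3))
      (EuclideanSpace ℂ (Fin 3)) (1 / 2 : ℝ)),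
    MemLp u₀ 2 volume → MemLp u₀ 3 volume →
    g.Represents (Literature.Analysis.FunctionSpaces.EuclideanSpace.complexify ∘ u₀) →
    Literature.Analysis.FluidPDE.IsWeaklyDivFree u₀ → AxisymUnfolded u₀ →
    Literature.Analysis.FluidPDE.HasGlobalKatoSolution ν u₀

theorem finiteEnergy_of_crux (h : AxisymmetricKatoGlobal) : AxisymKatoGlobalFiniteEnergy :=
  fun ν hν u₀ g _ hL3 hrep hdiv hax => h ν hν u₀ g hL3 hrep hdiv hax

/-! ## D5 — Kenig–Merle on the axisymmetric threshold: the rigidity half -/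

/-- **D5, rigidity half** ("no axisymmetric critical element"): every axisymmetric critical datum
whose `Ḣ^{1/2}` class has norm at most that of some axisymmetric blow-up datum is … — any such
formulation is the crux reworded; we record the cleanest one, *below-threshold globality at every
level*, which is literally `AxisymmetricKatoGlobal` with a vacuous extra binder, to make the point
checkable: -/
def AxisymThresholdBelowGlobal : Prop :=
  ∀ ν : ℝ, 0 < ν → ∀ ρ : ENNReal, ∀ (u₀ : EuclideanSpace ℝ (Fin 3) → EuclideanSpace ℝ (Fin 3))
    (g : Literature.Analysis.FunctionSpaces.HomSobolev (EuclideanSpace ℝ (Fin 3))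
      (EuclideanSpace ℂ (Fin 3)) (1 / 2 : ℝ)),
    MemLp u₀ 3 volume →
    g.Represents (Literature.Analysis.FunctionSpaces.EuclideanSpace.complexify ∘ u₀) →
    Literature.Analysis.FluidPDE.IsWeaklyDivFree u₀ → AxisymUnfolded u₀ → ‖g‖ₑ ≤ ρ →
    Literature.Analysis.FluidPDE.HasGlobalKatoSolution ν u₀

theorem thresholdBelowGlobal_iff_crux : AxisymThresholdBelowGlobal ↔ AxisymmetricKatoGlobal := by
  constructor
  · intro h ν hν u₀ g hL3 hrep hdiv hax
    exact h ν hν ⊤ u₀ g hL3 hrep hdiv hax le_top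
  · intro h ν hν ρ u₀ g hL3 hrep hdiv hax _
    exact h ν hν u₀ g hL3 hrep hdiv hax

/-! ## The proved rung: no O(2)-symmetric minimal blow-up datum -/

/-- Equivariance under the meridian reflection `σ (x₀,x₁,x₂) = (x₀,−x₁,x₂)` (the tree's `reflY`). -/
def ReflUnfolded (u₀ : EuclideanSpace ℝ (Fin 3) → EuclideanSpace ℝ (Fin 3)) : Prop :=
  ∀ x : EuclideanSpace ℝ (Fin 3),
    u₀ (Literature.Analysis.FluidPDE.reflY x) = Literature.Analysis.FluidPDE.reflY (u₀ x)

/-- **Proved rung of W0.** There is no Rusin–Šverák minimal blow-up datum that is equivariant under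
the full group O(2) about the `x₂`-axis (rotations `R_θ` and the meridian reflection `σ`): such a
field is axisymmetric WITHOUT swirl (`IsAxisymmetric.hasNoSwirl_of_reflY_eq`), and the landed
no-swirl stratum gives it a global Kato solution, contradicting the minimality clause. Sorry-free
over the tree (axioms: propext, Classical.choice, Quot.sound). -/
theorem noO2MinimalBlowupDatum :
    ∀ ν : ℝ, 0 < ν →
      ¬ ∃ (u₀ : EuclideanSpace ℝ (Fin 3) → EuclideanSpace ℝ (Fin 3))
          (g : Literature.Analysis.FunctionSpaces.HomSobolev (EuclideanSpace ℝ (Fin 3))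
            (EuclideanSpace ℂ (Fin 3)) (1 / 2 : ℝ)),
        Literature.Analysis.FluidPDE.IsMinimalBlowupDatum ν u₀ g ∧ AxisymUnfolded u₀ ∧ ReflUnfolded u₀ := by
  rintro ν hν ⟨u₀, g, ⟨hL3, -, hdiv, -, hnot⟩, hax, hσ⟩
  have hax' : Literature.Analysis.FluidPDE.IsAxisymmetric u₀ := fun θ x => hax θ x
  exact hnot
    (Summit.NavierStokesRegularity.NavierStokesRegularity.Theorems.AxisymmetricKatoGlobal.NoSwirlStratum.axisymmetricKatoGlobal_noSwirl_stratum
      ν hν u₀ hL3 hdiv (fun θ x => hax θ x) (hax'.hasNoSwirl_of_reflY_eq hσ))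

/-! ## Route-level note (for the tenure planner; NOT a crux output): the dihedral bypass -/

/-- `D_n`-symmetry about the `x₂`-axis: `n`-fold rotational symmetry together with the meridian
reflection. -/
def DihedralUnfolded (n : ℕ) (u₀ : EuclideanSpace ℝ (Fin 3) → EuclideanSpace ℝ (Fin 3)) : Prop :=
  PFoldUnfolded n u₀ ∧ ReflUnfolded u₀

/-- Smith-type crux with DIHEDRAL groups: Clay failure ⇒ for every `N` a `D_n`-symmetric minimal
blow-up datum with `n ≥ max(N,2)` (Oliver 1975: every action of `D_n` on a finite `𝔽_p`-acyclic
complex has a fixed point — `P ◁ Q ◁ G` with `P` the `p`-part of `C_n`, `Q = C_n`, `G/Q = ℤ/2`). -/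
def MinimalDatumDihedral : Prop :=
  ∀ ν : ℝ, 0 < ν → (∃ v₀ : EuclideanSpace ℝ (Fin 3) → EuclideanSpace ℝ (Fin 3), ContDiff ℝ (⊤ : ℕ∞) v₀ ∧ Literature.Analysis.FluidPDE.NSWave0.IsDivFree v₀ ∧ Literature.Analysis.FluidPDE.HasRapidSpatialDecay v₀ ∧ ¬ ∃ (u : ℝ → EuclideanSpace ℝ (Fin 3) → EuclideanSpace ℝ (Fin 3)) (p : ℝ → EuclideanSpace ℝ (Fin 3) → ℝ), Literature.Analysis.FluidPDE.IsSmoothOnHalfSpace u ∧ Literature.Analysis.FluidPDE.IsSmoothOnHalfSpace p ∧ Literature.Analysis.FluidPDE.IsNavierStokesSolution ν 0 v₀ u p ∧ Literature.Analysis.FluidPDE.HasBoundedEnergy u) →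
    ∀ N : ℕ, ∃ n : ℕ, N ≤ n ∧ 2 ≤ n ∧
      ∃ (u₀ : EuclideanSpace ℝ (Fin 3) → EuclideanSpace ℝ (Fin 3))
        (g : Literature.Analysis.FunctionSpaces.HomSobolev (EuclideanSpace ℝ (Fin 3))
          (EuclideanSpace ℂ (Fin 3)) (1 / 2 : ℝ)),
      Literature.Analysis.FluidPDE.IsMinimalBlowupDatum ν u₀ g ∧ DihedralUnfolded n u₀

/-- Compactness upgrade with the reflection carried along (same mechanism as the PROVED
`PFoldToAxisymmetric`: closure of `⋃ D_{n_j}` about a limiting axis is `O(2)`). -/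
def DihedralToO2 : Prop :=
  ∀ ν : ℝ, 0 < ν →
    (∀ N : ℕ, ∃ n : ℕ, N ≤ n ∧ 2 ≤ n ∧
      ∃ (u₀ : EuclideanSpace ℝ (Fin 3) → EuclideanSpace ℝ (Fin 3))
        (g : Literature.Analysis.FunctionSpaces.HomSobolev (EuclideanSpace ℝ (Fin 3))
          (EuclideanSpace ℂ (Fin 3)) (1 / 2 : ℝ)),
      Literature.Analysis.FluidPDE.IsMinimalBlowupDatum ν u₀ g ∧ DihedralUnfolded n u₀) →
    ∃ (u₀ : EuclideanSpace ℝ (Fin 3) → EuclideanSpace ℝ (Fin 3))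
      (g : Literature.Analysis.FunctionSpaces.HomSobolev (EuclideanSpace ℝ (Fin 3))
        (EuclideanSpace ℂ (Fin 3)) (1 / 2 : ℝ)),
    Literature.Analysis.FluidPDE.IsMinimalBlowupDatum ν u₀ g ∧ AxisymUnfolded u₀ ∧ ReflUnfolded u₀

/-- The route's deciding theorem re-run with dihedral symmetry: NO axisymmetric-with-swirl input
(`AxisymmetricKatoGlobal`) is needed — its role is played by the PROVED rung
`noO2MinimalBlowupDatum`. All open content then sits in `MinimalDatumDihedral` (+ the M-sized
`DihedralToO2`). -/
theorem closes_via_dihedral (h₂ : MinimalDatumDihedral) (h₄ : DihedralToO2) :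
    NavierStokesRegularity := by
  show Literature.NS.NavierStokesExistenceSmoothR3
  intro ν hν u₀ hsm hdiv hdec
  by_contra hno
  exact noO2MinimalBlowupDatum ν hν (h₄ ν hν (h₂ ν hν ⟨u₀, hsm, hdiv, hdec, hno⟩))

end Summit.NavierStokesRegularity.NavierStokesRegularity.Cruxes.AxisymmetricKatoGlobal.StrategistS17g3
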